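import Summits.HodgeConjecture.CorCM.IrreducibleOddWeightsCanonicalPivotBound
import Summits.HodgeConjecture.CorCM.IrreducibleOddWeightsDefectHodgeWeights
import HarnessLib

/-!
# Canonical pivot, X: the trace bound from BOTH sides and on HODGE WEIGHTS — the defect is at most half the smaller
# number of complex trace classes, and so is the number of independent non-blockwise balanced weights of `A₀ × A₁`

COR-CM (cell `pub-hodgecm2`, binder seat `b16` gen 65, count-neutral claim CANONICAL PIVOT + HODGE WEIGHTS, file C11 —
CM fields; theorems only, no definition, no named fact, no `sorry`).  NEW as stated, hence under `Summits/`.  HONEST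
FRAMING: unconditional inequalities for `dim MT(A₀ × A₁)` and for the space of Galois-balanced weights of `A₀ × A₁`
(Pohlmann's supports of Hodge classes); no Hodge class is claimed algebraic; `HC_CM` is neither used nor asserted.

C9 (`IrreducibleOddWeightsCanonicalPivotBound`): `2·(dim Hg(A₀) + dim Hg(A₁) − dim Hg(A₀ × A₁)) ≤ c₀`, the number of
complex trace classes of `Hom(K₀, ℂ)` for `L₁`; C6 (`IrreducibleOddWeightsDefectHodgeWeights`): `dim B(Φ₀, Φ₁) =
dim B(Φ₀) + dim B(Φ₁) + defect`.  Here: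

* **`two_mul_cmTypeRank_add_le_min_card_traceClasses`** — the bound from BOTH sides: `2·defect ≤ min(c₀, c₁)`, `c₁` the
  number of complex trace classes of `Hom(K₁, ℂ)` for `L₀` (the defect is symmetric, the two trace counts are not).
* **`two_mul_finrank_ker_familyType_le`** — ON HODGE WEIGHTS: `2·dim B(Φ₀, Φ₁) ≤ 2·(dim B(Φ₀) + dim B(Φ₁)) + min(c₀, c₁)`:
  the Galois-balanced rational weights on `Hom(K₀, ℂ) ⊔ Hom(K₁, ℂ)` (supports of the Hodge classes on all `A₀^a × A₁^b`,
  Pohlmann) exceed the blockwise-balanced ones (exterior products) by at most HALF THE SMALLER NUMBER OF COMPLEX TRACE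
  CLASSES — e.g. by at most one when one of the mutual traces is an imaginary quadratic field, by nothing when one is
  real (C2/C7/C8), whatever the types and dimensions.

## References

* [Gordon1999HodgeAVSurvey] B. B. Gordon, *A survey of the Hodge conjecture for abelian varieties*, §9.2–9.3, 7.5–7.7.
* [MoonenZarhin1999LowDim] B. Moonen, Yu. Zarhin, Math. Ann. 315 (1999), Thm. (0.2), §3 (3.1).
* [Pohlmann1968] H. Pohlmann, Ann. of Math. 88 (1968), Thm. 1 (through [Gordon1999HodgeAVSurvey, §9.2]).
-/

set_option autoImplicit false

noncomputable section

open scoped BigOperators Classical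

open NumberField Module IntermediateField

namespace Summit.HodgeConjecture.CorCM

open Literature.NumberTheory.ComplexMultiplication
open Literature.AlgebraicGeometry.Motives (CMType)
open Literature.AlgebraicGeometry.Pohlmann1968

variable {I : Type} [Fintype I] {K : I → Type} [∀ i, Field (K i)] [∀ i, NumberField (K i)] [∀ i, IsCMField (K i)]

/-- **THE TRACE BOUND FROM BOTH SIDES: `2·(dim Hg(A₀) + dim Hg(A₁) − dim Hg(A₀ × A₁)) ≤ min(c₀, c₁)`**, `c₀` (resp. `c₁`)
the number of complex trace classes of `Hom(K₀, ℂ)` for `L₁` (resp. of `Hom(K₁, ℂ)` for `L₀`) — for any two CM fields and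
any two types. [cite: Gordon1999HodgeAVSurvey, §3 Theorem (proof) and 7.5–7.7] [cite: MoonenZarhin1999LowDim, Thm. (0.2)] -/
theorem two_mul_cmTypeRank_add_le_min_card_traceClasses {i₀ i₁ : I} (h01 : i₀ ≠ i₁) (hI : ∀ l, l = i₀ ∨ l = i₁)
    (Φ : ∀ i, CMType (K i)) :
    2 * (cmTypeRank (Φ i₀) + cmTypeRank (Φ i₁)) ≤ 2 * (CMAlgebra.cmFamilyRank Φ + 1) + min
      ((Finset.univ.image fun a : K i₀ →+* ℂ =>
          Finset.univ.filter (fun t : K i₀ →+* ℂ => ∀ k : K i₀, a k ∈ normalClosure ℚ (K i₁) ℂ → t k = a k)).filter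
        fun C => C.image (fun t => (starRingAut : ℂ ≃+* ℂ) • t) ≠ C).card
      ((Finset.univ.image fun a : K i₁ →+* ℂ =>
          Finset.univ.filter (fun t : K i₁ →+* ℂ => ∀ k : K i₁, a k ∈ normalClosure ℚ (K i₀) ℂ → t k = a k)).filter
        fun C => C.image (fun t => (starRingAut : ℂ ≃+* ℂ) • t) ≠ C).card := by
  have h₀ := two_mul_cmTypeRank_add_le_card_traceClasses h01 hI Φ
  have h₁ := two_mul_cmTypeRank_add_le_card_traceClasses h01.symm (fun l => (hI l).symm) Φ
  rcases le_total
    ((Finset.univ.image fun a : K i₀ →+* ℂ =>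
          Finset.univ.filter (fun t : K i₀ →+* ℂ => ∀ k : K i₀, a k ∈ normalClosure ℚ (K i₁) ℂ → t k = a k)).filter
        fun C => C.image (fun t => (starRingAut : ℂ ≃+* ℂ) • t) ≠ C).card
    ((Finset.univ.image fun a : K i₁ →+* ℂ =>
          Finset.univ.filter (fun t : K i₁ →+* ℂ => ∀ k : K i₁, a k ∈ normalClosure ℚ (K i₀) ℂ → t k = a k)).filter
        fun C => C.image (fun t => (starRingAut : ℂ ≃+* ℂ) • t) ≠ C).card with hle | hle
  · rw [min_eq_left hle]; omega
  · rw [min_eq_right hle]; omega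

/-- **ON HODGE WEIGHTS: `2·dim B(Φ₀, Φ₁) ≤ 2·(dim B(Φ₀) + dim B(Φ₁)) + c₀`** — the Galois-balanced rational weights of the
product exceed the blockwise-balanced ones by at most half the number of complex trace classes of `Hom(K₀, ℂ)` for
`L₁` (C6's dictionary with C9's bound). [cite: Gordon1999HodgeAVSurvey, §9.2–9.3 and 7.5–7.7]
[cite: MoonenZarhin1999LowDim, Thm. (0.2)] -/
theorem two_mul_finrank_ker_familyType_le {i₀ i₁ : I} (h01 : i₀ ≠ i₁) (hI : ∀ l, l = i₀ ∨ l = i₁)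
    (Φ : ∀ i, CMType (K i)) :
    2 * Module.finrank ℚ (LinearMap.ker (Matrix.of fun (g : ℂ ≃+* ℂ) (x : (i : I) × (K i →+* ℂ)) =>
        antiVec (CMAlgebra.familyType Φ) g x).mulVecLin) ≤
      2 * (Module.finrank ℚ (LinearMap.ker
            (Matrix.of fun (g : ℂ ≃+* ℂ) (x : K i₀ →+* ℂ) => antiVec (Φ i₀).1 g x).mulVecLin) +
          Module.finrank ℚ (LinearMap.ker
            (Matrix.of fun (g : ℂ ≃+* ℂ) (x : K i₁ →+* ℂ) => antiVec (Φ i₁).1 g x).mulVecLin)) +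
        ((Finset.univ.image fun a : K i₀ →+* ℂ =>
            Finset.univ.filter (fun t : K i₀ →+* ℂ => ∀ k : K i₀, a k ∈ normalClosure ℚ (K i₁) ℂ → t k = a k)).filter
          fun C => C.image (fun t => (starRingAut : ℂ ≃+* ℂ) • t) ≠ C).card := by
  haveI : Nonempty I := ⟨i₀⟩
  have hB := finrank_ker_familyType_add_cmFamilyRank_add_card_eq Φ
  have hR := two_mul_cmTypeRank_add_le_card_traceClasses h01 hI Φ
  have hcard : Fintype.card I = 2 := by
    rw [← Finset.card_univ, show (Finset.univ : Finset I) = {i₀, i₁} from Finset.ext fun j => by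
      simpa only [Finset.mem_univ, Finset.mem_insert, Finset.mem_singleton, true_iff] using hI j,
      Finset.card_pair h01]
  rw [IrrOdd.sum_eq_add_of_pair _ hI h01, IrrOdd.sum_eq_add_of_pair _ hI h01, hcard] at hB
  omega

/-- **… and from both sides: `2·dim B(Φ₀, Φ₁) ≤ 2·(dim B(Φ₀) + dim B(Φ₁)) + min(c₀, c₁)`** — at most `½·min(c₀, c₁)`
independent non-blockwise Galois-balanced weights (supports of MIXED exceptional Hodge classes on the `A₀^a × A₁^b`): at
most one when a mutual trace is imaginary quadratic, none when one is real. [cite: Gordon1999HodgeAVSurvey, §9.2–9.3 and 7.5–7.7]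
[cite: MoonenZarhin1999LowDim, Thm. (0.2)] -/
theorem two_mul_finrank_ker_familyType_le_min {i₀ i₁ : I} (h01 : i₀ ≠ i₁) (hI : ∀ l, l = i₀ ∨ l = i₁)
    (Φ : ∀ i, CMType (K i)) :
    2 * Module.finrank ℚ (LinearMap.ker (Matrix.of fun (g : ℂ ≃+* ℂ) (x : (i : I) × (K i →+* ℂ)) =>
        antiVec (CMAlgebra.familyType Φ) g x).mulVecLin) ≤
      2 * (Module.finrank ℚ (LinearMap.ker
            (Matrix.of fun (g : ℂ ≃+* ℂ) (x : K i₀ →+* ℂ) => antiVec (Φ i₀).1 g x).mulVecLin) +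
          Module.finrank ℚ (LinearMap.ker
            (Matrix.of fun (g : ℂ ≃+* ℂ) (x : K i₁ →+* ℂ) => antiVec (Φ i₁).1 g x).mulVecLin)) + min
        ((Finset.univ.image fun a : K i₀ →+* ℂ =>
            Finset.univ.filter (fun t : K i₀ →+* ℂ => ∀ k : K i₀, a k ∈ normalClosure ℚ (K i₁) ℂ → t k = a k)).filter
          fun C => C.image (fun t => (starRingAut : ℂ ≃+* ℂ) • t) ≠ C).card
        ((Finset.univ.image fun a : K i₁ →+* ℂ =>
            Finset.univ.filter (fun t : K i₁ →+* ℂ => ∀ k : K i₁, a k ∈ normalClosure ℚ (K i₀) ℂ → t k = a k)).filter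
          fun C => C.image (fun t => (starRingAut : ℂ ≃+* ℂ) • t) ≠ C).card := by
  haveI : Nonempty I := ⟨i₀⟩
  have hB := finrank_ker_familyType_add_cmFamilyRank_add_card_eq Φ
  have hR := two_mul_cmTypeRank_add_le_min_card_traceClasses h01 hI Φ
  have hcard : Fintype.card I = 2 := by
    rw [← Finset.card_univ, show (Finset.univ : Finset I) = {i₀, i₁} from Finset.ext fun j => by
      simpa only [Finset.mem_univ, Finset.mem_insert, Finset.mem_singleton, true_iff] using hI j,
      Finset.card_pair h01]
  rw [IrrOdd.sum_eq_add_of_pair _ hI h01, IrrOdd.sum_eq_add_of_pair _ hI h01, hcard] at hB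
  omega

end Summit.HodgeConjecture.CorCM

end
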